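import Summits.MatrixMultiplication.OmegaCensus.CubeLawParity
import HarnessLib

/-!
# Law-attaining cube triples over `A` with `dim A/2A ≥ 3`: every coset part has size `1` or at least `7`

ω-census, family (b3).  Framing: lottery ticket; floor = certified bounds/negative ranges.

Parseval upgrade of the real-character parity theorem `parts_sgnSum_of_law_cube` (`CubeLawParity.lean`).  Dihedral-like
`G` over `A` (any `c₀`); a TPP triple with cube part sizes attaining `3|S||T||U| + 8 = 8|A|`; three homomorphisms
`ψ₁, ψ₂, ψ₃ : A →+ ZMod 2` jointly onto `𝔽₂³` (i.e. `dim_{𝔽₂} A/2A ≥ 3`).  For each of the `7` non-zero `w ∈ 𝔽₂³`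
the character `χ_w = (−1)^{w·ψ}` is non-trivial, so `χ_w(T₀) = ±1`; with `χ_0(T₀) = |T₀| = x`, Parseval on `𝔽₂³`
gives `x² + 7 = ∑_w χ_w(T₀)² = 8 · #{(t,t') ∈ T₀² : ψ t = ψ t'} ≥ 8x`, i.e. `(x − 1)(x − 7) ≥ 0`.

* `no_law_cube_part_small`: hence no coset part has size `x` with `2 ≤ x ≤ 6` (at even `|A|` the sizes are odd, so
  this excludes parts `3` and `5`); `_left`/`_right` versions by rotation.
Census use: the rank-`≥ 3` abelian groups of order `64` (shape `(1,3,7)`), `ℤ₂³×ℤ₁₇` at `|A| = 136` (shapes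
`(1,5,9), (1,3,15), (3,3,5)` — now including the part-`5` shape), `ℤ₂³×ℤ₃₅` at `280`, and the rank-`≥ 3` groups of
order `256` for `(1,5,17)`.
-/

namespace Summit.MatrixMultiplication.OmegaCensus

open Literature.Combinatorics.Additive Finset

/-! ## Characters of `𝔽₂³` -/

section F2Cube

/-- Orthogonality of the `±1`-characters of `𝔽₂³`: `∑_w (−1)^{w·u} = 8·[u = 0]`. [folklore] -/
theorem f2cube_orthogonality (u : ZMod 2 × ZMod 2 × ZMod 2) :
    (∑ w : ZMod 2 × ZMod 2 × ZMod 2,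
        (if w.1 * u.1 + w.2.1 * u.2.1 + w.2.2 * u.2.2 = 0 then (1 : ℤ) else -1)) = if u = 0 then 8 else 0 := by
  revert u; decide

/-- Multiplicativity in the second argument: `(−1)^{w·u} (−1)^{w·u'} = (−1)^{w·(u+u')}`. [folklore] -/
theorem f2cube_mul (w u u' : ZMod 2 × ZMod 2 × ZMod 2) :
    (if w.1 * u.1 + w.2.1 * u.2.1 + w.2.2 * u.2.2 = 0 then (1 : ℤ) else -1) *
        (if w.1 * u'.1 + w.2.1 * u'.2.1 + w.2.2 * u'.2.2 = 0 then (1 : ℤ) else -1) =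
      (if w.1 * (u + u').1 + w.2.1 * (u + u').2.1 + w.2.2 * (u + u').2.2 = 0 then (1 : ℤ) else -1) := by
  revert w u u'; decide

/-- Every non-zero `w ∈ 𝔽₂³` pairs to `1` with some `z`. [folklore] -/
theorem f2cube_exists_pair_one (w : ZMod 2 × ZMod 2 × ZMod 2) (hw : w ≠ 0) :
    ∃ z : ZMod 2 × ZMod 2 × ZMod 2, w.1 * z.1 + w.2.1 * z.2.1 + w.2.2 * z.2.2 = 1 := by
  revert w; decide

/-- `𝔽₂³` has `7` non-zero vectors. [folklore] -/
theorem f2cube_card_ne_zero : (univ.filter fun w : ZMod 2 × ZMod 2 × ZMod 2 => w ≠ 0).card = 7 := by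
  decide

end F2Cube

/-! ## The Parseval bound -/

section DihedralLike

variable {A : Type*} [AddCommGroup A] [DecidableEq A] [Fintype A] {G : Type} [Group G] [DecidableEq G]
  {ρ τ : A → G} {c₀ : A} {S T U : Finset G}

/-- **Cube law shape over `A` with `dim A/2A ≥ 3` ⇒ `|T₀| ∉ [2, 6]`.**  Dihedral-like `G` over `A`; three
homomorphisms `A →+ ZMod 2` jointly onto `𝔽₂³`; then no TPP triple with cube part sizes and `2 ≤ |T₀| ≤ 6` attains
`3|S||T||U| + 8 = 8|A|`. [folklore] -/
theorem no_law_cube_part_small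
    (hρρ : ∀ a b, ρ a * ρ b = ρ (a + b)) (hρτ : ∀ a b, ρ a * τ b = τ (b - a))
    (hτρ : ∀ a b, τ a * ρ b = τ (a + b)) (hττ : ∀ a b, τ a * τ b = ρ (c₀ + b - a))
    (hρ : Function.Injective ρ) (hτ : Function.Injective τ) (hne : ∀ a b, ρ a ≠ τ b)
    (hsurj : ∀ g, (∃ a, ρ a = g) ∨ (∃ a, τ a = g))
    (ψ₁ ψ₂ ψ₃ : A →+ ZMod 2) (hψ : ∀ v : ZMod 2 × ZMod 2 × ZMod 2, ∃ a, (ψ₁ a, ψ₂ a, ψ₃ a) = v)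
    (h : TripleProductProperty S T U)
    (hS : (univ.filter fun a : A => ρ a ∈ S).card = (univ.filter fun a : A => τ a ∈ S).card)
    (hT : (univ.filter fun a : A => ρ a ∈ T).card = (univ.filter fun a : A => τ a ∈ T).card)
    (hU : (univ.filter fun a : A => ρ a ∈ U).card = (univ.filter fun a : A => τ a ∈ U).card)
    (hsmall : 2 ≤ (univ.filter fun a : A => ρ a ∈ T).card ∧ (univ.filter fun a : A => ρ a ∈ T).card ≤ 6)
    (hV : 3 * (S.card * T.card * U.card) + 8 = 8 * Fintype.card A) : False := by
  set T₀ := univ.filter fun a : A => ρ a ∈ T with hT₀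
  -- the map to `𝔽₂³` and the characters `χ_w`
  let Ψ : A → ZMod 2 × ZMod 2 × ZMod 2 := fun a => (ψ₁ a, ψ₂ a, ψ₃ a)
  have hΨadd : ∀ a b, Ψ (a + b) = Ψ a + Ψ b := fun a b => by
    simp only [Ψ, map_add, Prod.mk_add_mk]
  let s : ZMod 2 × ZMod 2 × ZMod 2 → ZMod 2 × ZMod 2 × ZMod 2 → ℤ :=
    fun w u => if w.1 * u.1 + w.2.1 * u.2.1 + w.2.2 * u.2.2 = 0 then 1 else -1
  -- each non-zero `w` gives `χ_w(T₀)² = 1`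
  have hsq : ∀ w : ZMod 2 × ZMod 2 × ZMod 2, w ≠ 0 → (∑ t ∈ T₀, s w (Ψ t)) ^ 2 = 1 := by
    intro w hw
    let φ : A →+ ZMod 2 :=
      { toFun := fun a => w.1 * ψ₁ a + w.2.1 * ψ₂ a + w.2.2 * ψ₃ a
        map_zero' := by simp
        map_add' := fun a b => by simp only [map_add]; ring }
    obtain ⟨z, hz⟩ := f2cube_exists_pair_one w hw
    obtain ⟨a, ha⟩ := hψ z
    have hφ : ∃ a, φ a ≠ 0 := by
      refine ⟨a, ?_⟩
      show w.1 * ψ₁ a + w.2.1 * ψ₂ a + w.2.2 * ψ₃ a ≠ 0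
      have h1 : ψ₁ a = z.1 := congrArg Prod.fst ha
      have h2 : ψ₂ a = z.2.1 := congrArg (fun p => p.2.1) ha
      have h3 : ψ₃ a = z.2.2 := congrArg (fun p => p.2.2) ha
      rw [h1, h2, h3, hz]
      exact one_ne_zero
    have hval : ∀ a, (fun a => if φ a = 0 then (1 : ℤ) else -1) a = 1 ∨
        (fun a => if φ a = 0 then (1 : ℤ) else -1) a = -1 := fun a => by
      simp only; split_ifs
      · exact Or.inl rfl
      · exact Or.inr rfl
    have hmul : ∀ a b, (fun a => if φ a = 0 then (1 : ℤ) else -1) (a + b) =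
        (fun a => if φ a = 0 then (1 : ℤ) else -1) a * (fun a => if φ a = 0 then (1 : ℤ) else -1) b := by
      intro a b
      show s w (Ψ (a + b)) = s w (Ψ a) * s w (Ψ b)
      rw [hΨadd, f2cube_mul]
    have hsum : ∑ a, (fun a => if φ a = 0 then (1 : ℤ) else -1) a = 0 := by
      obtain ⟨a₁, ha₁⟩ := hφ
      have hs1 : (fun a => if φ a = 0 then (1 : ℤ) else -1) a₁ = -1 := by simp only; rw [if_neg ha₁]
      have h1 : ∑ a, (fun a => if φ a = 0 then (1 : ℤ) else -1) a =
          ∑ a, (fun a => if φ a = 0 then (1 : ℤ) else -1) (a + a₁) :=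
        (Fintype.sum_equiv (Equiv.addRight a₁) _ _ fun _ => rfl).symm
      simp only [hmul, hs1, ← Finset.sum_mul] at h1
      simp only at h1 ⊢
      linarith
    obtain ⟨-, -, hπ, -⟩ := parts_sgnSum_of_law_cube hρρ hρτ hτρ hττ hρ hτ hne hsurj h hS hT hU hV hmul hval hsum
    have hπ' : (∑ t ∈ T₀, s w (Ψ t)) = 1 ∨ (∑ t ∈ T₀, s w (Ψ t)) = -1 := hπ
    rcases hπ' with h1 | h1 <;> rw [h1] <;> norm_num
  -- the `w = 0` term is `|T₀|²`
  have h0 : (∑ t ∈ T₀, s 0 (Ψ t)) = T₀.card := by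
    simp only [s, Prod.fst_zero, Prod.snd_zero, zero_mul, add_zero, ↓reduceIte, sum_const, nsmul_eq_mul,
      mul_one]
  -- Parseval: `∑_w χ_w(T₀)² = 8 N`
  set N := ((T₀ ×ˢ T₀).filter fun p : A × A => Ψ p.1 + Ψ p.2 = 0).card with hN
  have hpars : (∑ w : ZMod 2 × ZMod 2 × ZMod 2, (∑ t ∈ T₀, s w (Ψ t)) ^ 2) = 8 * N := by
    have step : ∀ w : ZMod 2 × ZMod 2 × ZMod 2,
        (∑ t ∈ T₀, s w (Ψ t)) ^ 2 = ∑ p ∈ T₀ ×ˢ T₀, s w (Ψ p.1 + Ψ p.2) := by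
      intro w
      rw [sq, sum_mul_sum, ← sum_product']
      exact sum_congr rfl fun p _ => f2cube_mul w (Ψ p.1) (Ψ p.2)
    simp_rw [step]
    rw [sum_comm]
    have inner : ∀ p ∈ T₀ ×ˢ T₀, (∑ w : ZMod 2 × ZMod 2 × ZMod 2, s w (Ψ p.1 + Ψ p.2)) =
        if Ψ p.1 + Ψ p.2 = 0 then 8 else 0 := fun p _ => f2cube_orthogonality _
    rw [sum_congr rfl inner, ← sum_filter, sum_const, nsmul_eq_mul, mul_comm]
  -- split off `w = 0`: `|T₀|² + 7 = 8 N`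
  have hsplit : (∑ w : ZMod 2 × ZMod 2 × ZMod 2, (∑ t ∈ T₀, s w (Ψ t)) ^ 2) =
      (T₀.card : ℤ) ^ 2 + 7 := by
    rw [← Finset.sum_filter_add_sum_filter_not univ (fun w => w ≠ 0)]
    have hA7 : (∑ w ∈ univ.filter (fun w : ZMod 2 × ZMod 2 × ZMod 2 => w ≠ 0), (∑ t ∈ T₀, s w (Ψ t)) ^ 2) = 7 := by
      rw [sum_congr rfl fun w hw => hsq w (mem_filter.1 hw).2, sum_const, f2cube_card_ne_zero]
      norm_num
    have hB : (univ.filter fun w : ZMod 2 × ZMod 2 × ZMod 2 => ¬w ≠ 0) = {0} := by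
      ext w; simp
    rw [hA7, hB, sum_singleton, h0]
    ring
  -- the diagonal gives `N ≥ |T₀|`
  have hdiag : T₀.card ≤ N := by
    rw [hN]
    have : (T₀.image fun t => (t, t)) ⊆ (T₀ ×ˢ T₀).filter fun p : A × A => Ψ p.1 + Ψ p.2 = 0 := by
      intro p hp
      obtain ⟨t, ht, rfl⟩ := mem_image.1 hp
      refine mem_filter.2 ⟨mem_product.2 ⟨ht, ht⟩, ?_⟩
      show Ψ t + Ψ t = 0
      ext <;> simp only [Ψ, Prod.fst_add, Prod.snd_add, Prod.fst_zero, Prod.snd_zero] <;>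
        exact CharTwo.add_self_eq_zero _
    calc T₀.card = (T₀.image fun t => (t, t)).card :=
          (card_image_of_injective _ fun a b hab => (Prod.mk.injEq _ _ _ _ ▸ hab :).1).symm
      _ ≤ _ := card_le_card this
  -- arithmetic
  have key : (T₀.card : ℤ) ^ 2 + 7 = 8 * N := by rw [← hsplit, hpars]
  obtain ⟨h2, h6⟩ := hsmall
  have hx : (T₀.card : ℤ) ≤ N := by exact_mod_cast hdiag
  nlinarith

/-- The same with the small part in `S` (rotation `(U, S, T)`). [folklore] -/
theorem no_law_cube_part_small_left
    (hρρ : ∀ a b, ρ a * ρ b = ρ (a + b)) (hρτ : ∀ a b, ρ a * τ b = τ (b - a))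
    (hτρ : ∀ a b, τ a * ρ b = τ (a + b)) (hττ : ∀ a b, τ a * τ b = ρ (c₀ + b - a))
    (hρ : Function.Injective ρ) (hτ : Function.Injective τ) (hne : ∀ a b, ρ a ≠ τ b)
    (hsurj : ∀ g, (∃ a, ρ a = g) ∨ (∃ a, τ a = g))
    (ψ₁ ψ₂ ψ₃ : A →+ ZMod 2) (hψ : ∀ v : ZMod 2 × ZMod 2 × ZMod 2, ∃ a, (ψ₁ a, ψ₂ a, ψ₃ a) = v)
    (h : TripleProductProperty S T U)
    (hS : (univ.filter fun a : A => ρ a ∈ S).card = (univ.filter fun a : A => τ a ∈ S).card)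
    (hT : (univ.filter fun a : A => ρ a ∈ T).card = (univ.filter fun a : A => τ a ∈ T).card)
    (hU : (univ.filter fun a : A => ρ a ∈ U).card = (univ.filter fun a : A => τ a ∈ U).card)
    (hsmall : 2 ≤ (univ.filter fun a : A => ρ a ∈ S).card ∧ (univ.filter fun a : A => ρ a ∈ S).card ≤ 6)
    (hV : 3 * (S.card * T.card * U.card) + 8 = 8 * Fintype.card A) : False :=
  no_law_cube_part_small hρρ hρτ hτρ hττ hρ hτ hne hsurj ψ₁ ψ₂ ψ₃ hψ h.rotate.rotate hU hS hT hsmall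
    (by rw [← hV]; ring)

/-- The same with the small part in `U` (rotation `(T, U, S)`). [folklore] -/
theorem no_law_cube_part_small_right
    (hρρ : ∀ a b, ρ a * ρ b = ρ (a + b)) (hρτ : ∀ a b, ρ a * τ b = τ (b - a))
    (hτρ : ∀ a b, τ a * ρ b = τ (a + b)) (hττ : ∀ a b, τ a * τ b = ρ (c₀ + b - a))
    (hρ : Function.Injective ρ) (hτ : Function.Injective τ) (hne : ∀ a b, ρ a ≠ τ b)
    (hsurj : ∀ g, (∃ a, ρ a = g) ∨ (∃ a, τ a = g))
    (ψ₁ ψ₂ ψ₃ : A →+ ZMod 2) (hψ : ∀ v : ZMod 2 × ZMod 2 × ZMod 2, ∃ a, (ψ₁ a, ψ₂ a, ψ₃ a) = v)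
    (h : TripleProductProperty S T U)
    (hS : (univ.filter fun a : A => ρ a ∈ S).card = (univ.filter fun a : A => τ a ∈ S).card)
    (hT : (univ.filter fun a : A => ρ a ∈ T).card = (univ.filter fun a : A => τ a ∈ T).card)
    (hU : (univ.filter fun a : A => ρ a ∈ U).card = (univ.filter fun a : A => τ a ∈ U).card)
    (hsmall : 2 ≤ (univ.filter fun a : A => ρ a ∈ U).card ∧ (univ.filter fun a : A => ρ a ∈ U).card ≤ 6)
    (hV : 3 * (S.card * T.card * U.card) + 8 = 8 * Fintype.card A) : False :=
  no_law_cube_part_small hρρ hρτ hτρ hττ hρ hτ hne hsurj ψ₁ ψ₂ ψ₃ hψ h.rotate hT hU hS hsmall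
    (by rw [← hV]; ring)

end DihedralLike

end Summit.MatrixMultiplication.OmegaCensus
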